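import Mathlib
import HarnessLib
import Literature.Analysis.FluidPDE.VectorCalculus
import Literature.Analysis.FluidPDE.VorticityCalculus
import Literature.Analysis.FluidPDE.VorticityEquation
import Literature.Analysis.FluidPDE.LerayProfileCalculus
import Literature.Analysis.FluidPDE.AxisymmetricVorticityTransport
import Literature.Analysis.FluidPDE.TypeIAncientMildClassical
import Summits.NavierStokesRegularity.NavierStokesRegularity.Theorems.LocalSineTubeDoorProfileAlignedWindowRigidityAncient
import Summits.NavierStokesRegularity.NavierStokesRegularity.Theorems.PoloidalWindowDoorPoloidalWindowRigidityWindow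
import Summits.NavierStokesRegularity.NavierStokesRegularity.Theorems.PoloidalWindowDoorPoloidalWindowRigidityDegenerate
import Summits.NavierStokesRegularity.NavierStokesRegularity.Theorems.PoloidalWindowDoorPoloidalWindowRigidityClassRate
import Summits.NavierStokesRegularity.NavierStokesRegularity.Theorems.LocalHelicityTubeDoorFrobeniusWindowRigidityWindow
import Summits.NavierStokesRegularity.NavierStokesRegularity.Theorems.LocalSineTubeDoorStretchingDoor
import Summits.NavierStokesRegularity.NavierStokesRegularity.Theorems.LocalSineTubeDoorBoundedSubsolutionMaxPrinciple

/-!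
# The one-window door family — ENSTROPHY-PRODUCTION-FREE Type-I profiles are trivial (profile side of the
# enstrophy-production door)

Cell ns-regularity-ideate, seat p6 (route-directed support for nsreg-p1's door family; anchor
`--supports stmt-NavierStokesRegularity-20018`, the profile-rigidity item of the family).  The profile crux of the
door whose window scalar is the ENSTROPHY PRODUCTION (vortex-stretching rate) `ω·Sω = ⟪ω, Du ω⟫`, `ω = curl u`:

**a profile of the family's Type-I class** (rate `‖v(t,x)‖ ≤ C/√(−t)`, continuity on the open slab, unit-viscosity
Oseen–Duhamel identity, divergence-free slices) **with `⟪curl v(s), Dv(s) curl v(s)⟫ ≡ 0` on every slice `s < 0` is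
identically zero** (`eq_zero_of_production_eq_zero`).

Proof.  The profile is a classical Navier–Stokes solution on every window `(t₀, 0)`
(`IsTypeIAncientMild.exists_isClassicalNSSolutionOn_Ioo`); pairing its vorticity equation
`∂ₜω + (v·∇)ω = (ω·∇)v + Δω` with `ω` and using `Δ|ω|² = 2⟪Δω, ω⟫ + 2|∇ω|²` (tree `laplacian_inner_self_eq`) gives the
pointwise ENSTROPHY BALANCE `∂ₜ|ω|² + (v·∇)|ω|² − Δ|ω|² = 2⟪ω, Dv ω⟫ − 2|∇ω|²` (`enstrophyDensity_balance`), so without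
production `q = |ω|²` is a bounded SUB-solution of the drift–diffusion inequality on every slab `[t₀, t₁] × ℝ³`,
`t₁ < 0` (drift `v` bounded by the rate, `q ≤ (C₂/(−t₁))²` by the class vorticity rate
`…ClassRate.exists_curl_rate_of_class`); the whole-space maximum principle for bounded sub-solutions
(`…BoundedSubsolutionMaxPrinciple.le_of_bounded_subsolution`) gives `q(t₁, x) ≤ sup q(t₀, ·) ≤ (C₂/(−t₀))² → 0` as
`t₀ → −∞`; hence `ω ≡ 0` (`curl_eq_zero_of_production_eq_zero`) and irrotational profiles of the class vanish
(`…Degenerate`).  Window → slab: the production of a slice is real-analytic (`analyticOnNhd_production_slice`,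
`productionWindowToSlab`).

This strengthens the stretching door's profile theorem (`(ω·∇)v ≡ 0 ⇒ ⟪ω, (ω·∇)v⟫ ≡ 0`): at a locally Type-I
singularity the enstrophy production itself cannot fade on any similarity window.

WHAT THIS IS NOT: not a claim about Navier–Stokes regularity (Clay A) — the profile-rigidity half of a local regularity
CRITERION (conditional on local Type I) of the door family (bears_on LADDER-NS N0); establishment in the cell's sense
still requires the cross-family referee PASS + independent reproduction.
-/

noncomputable section

-- the summit and its single sub-problem share the name (CONVENTIONS §1), as in every Theorems file
set_option linter.dupNamespace false

namespace Summit.NavierStokesRegularity.NavierStokesRegularity.Theorems.LocalSineTubeDoorEnstrophyProductionProfileRigidity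

open MeasureTheory Set Function Filter Topology TopologicalSpace Metric InnerProductSpace
open scoped RealInnerProductSpace InnerProductSpace Laplacian ContDiff
open Literature.Analysis Literature.Analysis.FluidPDE
open Summit.NavierStokesRegularity.NavierStokesRegularity.Theorems.LocalSineTubeDoorProfileAlignedWindowRigidityAncient
open Summit.NavierStokesRegularity.NavierStokesRegularity.Theorems.PoloidalWindowDoorPoloidalWindowRigidityWindow
open Summit.NavierStokesRegularity.NavierStokesRegularity.Theorems.PoloidalWindowDoorPoloidalWindowRigidityDegenerate
open Summit.NavierStokesRegularity.NavierStokesRegularity.Theorems.PoloidalWindowDoorPoloidalWindowRigidityClassRate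
open Summit.NavierStokesRegularity.NavierStokesRegularity.Theorems.LocalHelicityTubeDoorFrobeniusWindowRigidityWindow
open Summit.NavierStokesRegularity.NavierStokesRegularity.Theorems.LocalSineTubeDoorStretchingDoor
open Summit.NavierStokesRegularity.NavierStokesRegularity.Theorems.LocalSineTubeDoorBoundedSubsolutionMaxPrinciple

variable {C : ℝ} {v : ℝ → EuclideanSpace ℝ (Fin 3) → EuclideanSpace ℝ (Fin 3)}

/-! ### the pointwise enstrophy balance of a classical solution -/

/-- **The local enstrophy balance.**  For a classical solution `(u, p)` of the unforced Navier–Stokes system with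
viscosity `ν` on an OPEN time set `S`, the enstrophy density `q = ⟪ω, ω⟫`, `ω = curl u`, satisfies pointwise at every
`t ∈ S`, `x`:  `∂ₜq + Dq(u) − νΔq = 2⟪ω, Du ω⟫ − 2ν |Dω|²_F`  (`|·|_F` the Frobenius norm; `∂ₜ` the one-sided time
derivative within `S`).  Ingredients: `HasDerivWithinAt.inner`, `fderiv_inner_apply`, the tree's `laplacian_inner_self_eq`
and the vorticity equation `IsClassicalNSSolutionOn.vorticity_eq`. -/
theorem enstrophyDensity_balance {S : Set ℝ} (hSo : IsOpen S) {ν : ℝ}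
    {u : ℝ → EuclideanSpace ℝ (Fin 3) → EuclideanSpace ℝ (Fin 3)} {p : ℝ → EuclideanSpace ℝ (Fin 3) → ℝ}
    (hns : IsClassicalNSSolutionOn S ν 0 u p) {t : ℝ} (ht : t ∈ S) (x : EuclideanSpace ℝ (Fin 3)) :
    timeDerivWithin S (fun τ y => ⟪curl (u τ) y, curl (u τ) y⟫_ℝ) t x +
        fderiv ℝ (fun y => ⟪curl (u t) y, curl (u t) y⟫_ℝ) x (u t x) -
        ν * (Δ (fun y => ⟪curl (u t) y, curl (u t) y⟫_ℝ)) x =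
      2 * ⟪curl (u t) x, fderiv ℝ (u t) x (curl (u t) x)⟫_ℝ - 2 * ν * frobeniusNormSq (fderiv ℝ (curl (u t)) x) := by
  have hS : UniqueDiffOn ℝ S := hSo.uniqueDiffOn
  -- smoothness of the slice and of its curl
  have hu3 : ContDiff ℝ 3 (u t) := contDiff_infty.1 (hns.contDiff_velocity ht) 3
  have hΩ2 : ContDiff ℝ 2 (curl (u t)) := contDiff_curl (n := 2) (by exact_mod_cast hu3)
  have hΩd : ∀ y, DifferentiableAt ℝ (curl (u t)) y := fun y => (hΩ2.differentiable (by norm_num)) y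
  -- (T) time derivative of `⟪ω, ω⟫`
  have hdω : HasDerivWithinAt (fun τ => vorticity u τ x) (timeDerivWithin S (vorticity u) t x) S t := by
    rw [timeDerivWithin_apply]
    exact ((hns.smooth_velocity.isSmoothSpaceTimeOn_vorticity hS).differentiableWithinAt_time ht x).hasDerivWithinAt
  have hprod := hdω.inner ℝ hdω
  have hT : timeDerivWithin S (fun τ y => ⟪curl (u τ) y, curl (u τ) y⟫_ℝ) t x =
      2 * ⟪curl (u t) x, timeDerivWithin S (vorticity u) t x⟫_ℝ := by
    rw [timeDerivWithin_apply]
    have h := hprod.derivWithin (hS t ht)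
    simp only [vorticity_apply] at h
    rw [h, real_inner_comm (curl (u t) x), two_mul]
  -- (X) the transport term
  have hX : fderiv ℝ (fun y => ⟪curl (u t) y, curl (u t) y⟫_ℝ) x (u t x) =
      2 * ⟪curl (u t) x, fderiv ℝ (curl (u t)) x (u t x)⟫_ℝ := by
    rw [fderiv_inner_apply ℝ (hΩd x) (hΩd x) (u t x), real_inner_comm (curl (u t) x), two_mul]
  -- (L) the Laplacian
  have hL : (Δ (fun y => ⟪curl (u t) y, curl (u t) y⟫_ℝ)) x =
      2 * ⟪(Δ (curl (u t))) x, curl (u t) x⟫_ℝ + 2 * frobeniusNormSq (fderiv ℝ (curl (u t)) x) :=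
    laplacian_inner_self_eq hΩ2 x
  -- (W) the vorticity equation against `ω`
  have hV := hns.vorticity_eq hS (by rw [hSo.interior_eq]; exact subset_closure) (fun _ _ y => curl_zero y) ht x
  have hW : ⟪curl (u t) x, timeDerivWithin S (vorticity u) t x⟫_ℝ + ⟪curl (u t) x, fderiv ℝ (curl (u t)) x (u t x)⟫_ℝ =
      ⟪curl (u t) x, fderiv ℝ (u t) x (curl (u t) x)⟫_ℝ + ν * ⟪curl (u t) x, (Δ (curl (u t))) x⟫_ℝ := by
    have h := congrArg (fun z => ⟪curl (u t) x, z⟫_ℝ) hV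
    simpa only [convect_apply, vorticity_apply, inner_add_right, real_inner_smul_right] using h
  have hc : ⟪(Δ (curl (u t))) x, curl (u t) x⟫_ℝ = ⟪curl (u t) x, (Δ (curl (u t))) x⟫_ℝ := real_inner_comm _ _
  rw [hT, hX, hL]
  linear_combination 2 * hW - 2 * ν * hc

/-! ### the class: production-free profiles -/

/-- **The enstrophy density of a production-free profile is a sub-solution** of `∂ₜq + Dq(v) − Δq ≤ 0` at every point
of the open slab (two-sided time derivative `deriv`), and `τ ↦ q(τ, x)` is differentiable there. -/
theorem enstrophy_subsolution_of_production_eq_zero (hrate : HasTypeITimeDecay C v)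
    (hcont : ContinuousOn (uncurry v) (Iio (0 : ℝ) ×ˢ univ))
    (hmild : ∀ s t : ℝ, s < t → t < 0 → ∀ x,
      v t x = UnboundedOperators.heatExtension (v s) (t - s) x - oseenDuhamel 1 s v v t x)
    (hdiv : ∀ t < 0, VectorCalculus.IsDivFree (v t))
    (hprod : ∀ s < 0, ∀ y, ⟪curl (v s) y, fderiv ℝ (v s) y (curl (v s) y)⟫_ℝ = 0) {t : ℝ} (ht : t < 0)
    (x : EuclideanSpace ℝ (Fin 3)) :
    HasDerivAt (fun τ => ⟪curl (v τ) x, curl (v τ) x⟫_ℝ) (deriv (fun τ => ⟪curl (v τ) x, curl (v τ) x⟫_ℝ) t) t ∧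
      deriv (fun τ => ⟪curl (v τ) x, curl (v τ) x⟫_ℝ) t +
          fderiv ℝ (fun y => ⟪curl (v t) y, curl (v t) y⟫_ℝ) x (v t x) -
          (Δ (fun y => ⟪curl (v t) y, curl (v t) y⟫_ℝ)) x ≤ 0 := by
  have hA : IsTypeIAncientMild C v := isTypeIAncientMild_of_class hrate hcont hmild hdiv
  have ht₀ : t - 1 < 0 := by linarith
  have htI : t ∈ Ioo (t - 1) 0 := ⟨by linarith, ht⟩
  obtain ⟨p, hcl⟩ := hA.exists_isClassicalNSSolutionOn_Ioo ht₀
  have hbal := enstrophyDensity_balance isOpen_Ioo hcl htI x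
  -- the time derivative within the open window is the two-sided derivative
  have hdω : HasDerivWithinAt (fun τ => vorticity v τ x) (timeDerivWithin (Ioo (t - 1) 0) (vorticity v) t x)
      (Ioo (t - 1) 0) t := by
    rw [timeDerivWithin_apply]
    exact ((hcl.smooth_velocity.isSmoothSpaceTimeOn_vorticity isOpen_Ioo.uniqueDiffOn).differentiableWithinAt_time
      htI x).hasDerivWithinAt
  have hq : HasDerivAt (fun τ => ⟪curl (v τ) x, curl (v τ) x⟫_ℝ)
      (⟪vorticity v t x, timeDerivWithin (Ioo (t - 1) 0) (vorticity v) t x⟫_ℝ +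
        ⟪timeDerivWithin (Ioo (t - 1) 0) (vorticity v) t x, vorticity v t x⟫_ℝ) t := by
    have h := (hdω.inner ℝ hdω).hasDerivAt (isOpen_Ioo.mem_nhds htI)
    simpa only [vorticity_apply] using h
  refine ⟨hq.differentiableAt.hasDerivAt, ?_⟩
  have hderiv : deriv (fun τ => ⟪curl (v τ) x, curl (v τ) x⟫_ℝ) t =
      timeDerivWithin (Ioo (t - 1) 0) (fun τ y => ⟪curl (v τ) y, curl (v τ) y⟫_ℝ) t x := by
    rw [timeDerivWithin_apply, derivWithin_of_isOpen isOpen_Ioo htI]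
  rw [hderiv]
  have h1 : (1 : ℝ) * (Δ (fun y => ⟪curl (v t) y, curl (v t) y⟫_ℝ)) x =
      (Δ (fun y => ⟪curl (v t) y, curl (v t) y⟫_ℝ)) x := one_mul _
  rw [← h1, hbal, hprod t ht x]
  have := frobeniusNormSq_nonneg (fderiv ℝ (curl (v t)) x)
  linarith

/-- **Production-free profiles of the class are irrotational**: the enstrophy density is a bounded sub-solution on
every slab `[t₀, t₁] × ℝ³`, `t₁ < 0`, so by the whole-space maximum principle `|ω(t₁, x)|² ≤ sup |ω(t₀, ·)|² ≤
(C₂/(−t₀))²`, which tends to `0` as `t₀ → −∞`. -/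
theorem curl_eq_zero_of_production_eq_zero (hrate : HasTypeITimeDecay C v)
    (hcont : ContinuousOn (uncurry v) (Iio (0 : ℝ) ×ˢ univ))
    (hmild : ∀ s t : ℝ, s < t → t < 0 → ∀ x,
      v t x = UnboundedOperators.heatExtension (v s) (t - s) x - oseenDuhamel 1 s v v t x)
    (hdiv : ∀ t < 0, VectorCalculus.IsDivFree (v t))
    (hprod : ∀ s < 0, ∀ y, ⟪curl (v s) y, fderiv ℝ (v s) y (curl (v s) y)⟫_ℝ = 0) :
    ∀ t < 0, ∀ x, curl (v t) x = 0 := by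
  have hA : IsTypeIAncientMild C v := isTypeIAncientMild_of_class hrate hcont hmild hdiv
  obtain ⟨C₂, hC₂⟩ := exists_curl_rate_of_class hrate hcont hmild
  have hC₂0 : 0 ≤ C₂ := by
    have h := hC₂ (-1) (by norm_num) 0
    rw [neg_neg, div_one] at h
    exact (norm_nonneg _).trans h
  -- the enstrophy density and its time derivative
  set q : ℝ → EuclideanSpace ℝ (Fin 3) → ℝ := fun τ y => ⟪curl (v τ) y, curl (v τ) y⟫_ℝ with hqdef
  set qt : ℝ → EuclideanSpace ℝ (Fin 3) → ℝ := fun τ y => deriv (fun τ' => q τ' y) τ with hqtdef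
  have hsmω : IsSmoothSpaceTimeOn (Iio 0) (vorticity v) :=
    (show IsSmoothSpaceTimeOn (Iio 0) v from hA.contDiffOn).isSmoothSpaceTimeOn_vorticity isOpen_Iio.uniqueDiffOn
  intro t₁ ht₁ x₁
  -- `q(t₁, x₁) ≤ (C₂/(−t₀))²` for every `t₀ < t₁`
  have hkey : ∀ t₀ < t₁, q t₁ x₁ ≤ (C₂ / (-t₀)) ^ 2 := by
    intro t₀ ht₀
    -- drift bound on `[t₀, t₁]`
    obtain ⟨B, hB⟩ := bdd_of_hasTypeITimeDecay hrate (-t₁ / 2) (by linarith)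
    have hbA : ∀ t ∈ Icc t₀ t₁, ∀ x, ‖v t x‖ ≤ B := fun t ht x => hB t (by linarith [ht.2]) x
    -- continuity of `q` on the closed slab
    have hq_c : ContinuousOn (uncurry q) (Icc t₀ t₁ ×ˢ univ) := by
      have hωc : ContinuousOn (uncurry (vorticity v)) (Icc t₀ t₁ ×ˢ univ) :=
        hsmω.continuousOn.mono (prod_mono (fun t ht => lt_of_le_of_lt ht.2 ht₁) Subset.rfl)
      have h : ContinuousOn (fun z => ⟪uncurry (vorticity v) z, uncurry (vorticity v) z⟫_ℝ) (Icc t₀ t₁ ×ˢ univ) :=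
        hωc.inner hωc
      refine h.congr fun z _ => ?_
      simp only [hqdef, uncurry, vorticity_apply]
    -- smooth slices
    have hq2 : ∀ t ∈ Icc t₀ t₁, ContDiff ℝ 2 (q t) := fun t ht => by
      have htn : t < 0 := lt_of_le_of_lt ht.2 ht₁
      have hΩ : ContDiff ℝ 2 (curl (v t)) :=
        contDiff_curl (n := 2) (analyticOnNhd_slice hcont (bdd_of_hasTypeITimeDecay hrate) hmild htn).contDiff
      exact hΩ.inner ℝ hΩ
    -- time derivative and the sub-solution inequality
    have hsub := fun t (ht : t ∈ Icc t₀ t₁) x =>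
      enstrophy_subsolution_of_production_eq_zero hrate hcont hmild hdiv hprod (lt_of_le_of_lt ht.2 ht₁) x
    have hqt : ∀ x, ∀ t ∈ Icc t₀ t₁, HasDerivAt (fun τ => q τ x) (qt t x) t := fun x t ht => (hsub t ht x).1
    have hlaw : ∀ t ∈ Icc t₀ t₁, ∀ x, qt t x + fderiv ℝ (q t) x (v t x) - (Δ (q t)) x ≤ 0 :=
      fun t ht x => (hsub t ht x).2
    -- bounds
    have hqbd : ∀ t < 0, ∀ x, q t x ≤ (C₂ / (-t)) ^ 2 := fun t ht x => by
      simp only [hqdef, real_inner_self_eq_norm_sq]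
      exact pow_le_pow_left₀ (norm_nonneg _) (hC₂ t ht x) 2
    have hbdd : ∀ t ∈ Icc t₀ t₁, ∀ x, |q t x| ≤ (C₂ / (-t₁)) ^ 2 := fun t ht x => by
      have htn : t < 0 := lt_of_le_of_lt ht.2 ht₁
      have hq0 : 0 ≤ q t x := by simp only [hqdef]; exact real_inner_self_nonneg
      rw [abs_of_nonneg hq0]
      refine (hqbd t htn x).trans ?_
      have h1 : C₂ / (-t) ≤ C₂ / (-t₁) := div_le_div_of_nonneg_left hC₂0 (by linarith) (by linarith [ht.2])
      exact pow_le_pow_left₀ (div_nonneg hC₂0 (by linarith)) h1 2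
    have hinit : ∀ x, q t₀ x ≤ (C₂ / (-t₀)) ^ 2 := fun x => hqbd t₀ (ht₀.trans ht₁) x
    exact le_of_bounded_subsolution ht₀ hbA hq_c hq2 hqt hlaw hbdd hinit t₁ ⟨ht₀.le, le_rfl⟩ x₁
  -- let `t₀ → −∞`
  have hq0 : 0 ≤ q t₁ x₁ := by simp only [hqdef]; exact real_inner_self_nonneg
  have hqle : q t₁ x₁ ≤ 0 := by
    refine le_of_forall_pos_le_add fun η hη => ?_
    -- choose `t₀` with `(C₂/(−t₀))² ≤ η`: `−t₀ ≥ C₂/√η`, e.g. `t₀ = t₁ − 1 − C₂/√η`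
    set t₀ : ℝ := t₁ - 1 - C₂ / Real.sqrt η with ht₀def
    have hsη : 0 < Real.sqrt η := Real.sqrt_pos.2 hη
    have hq' : 0 ≤ C₂ / Real.sqrt η := div_nonneg hC₂0 hsη.le
    have ht₀ : t₀ < t₁ := by rw [ht₀def]; linarith
    have hnt₀ : C₂ / Real.sqrt η ≤ -t₀ := by rw [ht₀def]; linarith
    have hpos : 0 < -t₀ := by linarith
    have h1 : C₂ / (-t₀) ≤ Real.sqrt η := by
      rw [div_le_iff₀ hpos]
      calc C₂ = C₂ / Real.sqrt η * Real.sqrt η := by field_simp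
        _ ≤ -t₀ * Real.sqrt η := mul_le_mul_of_nonneg_right hnt₀ hsη.le
        _ = Real.sqrt η * -t₀ := mul_comm _ _
    have h2 : (C₂ / (-t₀)) ^ 2 ≤ Real.sqrt η ^ 2 := pow_le_pow_left₀ (div_nonneg hC₂0 hpos.le) h1 2
    rw [Real.sq_sqrt hη.le] at h2
    linarith [hkey t₀ ht₀]
  have hq00 : q t₁ x₁ = 0 := le_antisymm hqle hq0
  simpa only [hqdef, inner_self_eq_zero] using hq00

/-- **ENSTROPHY-PRODUCTION-FREE TYPE-I PROFILES ARE TRIVIAL.** -/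
theorem eq_zero_of_production_eq_zero (hrate : HasTypeITimeDecay C v)
    (hcont : ContinuousOn (uncurry v) (Iio (0 : ℝ) ×ˢ univ))
    (hmild : ∀ s t : ℝ, s < t → t < 0 → ∀ x,
      v t x = UnboundedOperators.heatExtension (v s) (t - s) x - oseenDuhamel 1 s v v t x)
    (hdiv : ∀ t < 0, VectorCalculus.IsDivFree (v t))
    (hprod : ∀ s < 0, ∀ y, ⟪curl (v s) y, fderiv ℝ (v s) y (curl (v s) y)⟫_ℝ = 0) : ∀ t < 0, ∀ x, v t x = 0 :=
  eq_zero_of_irrotational hrate hcont hmild hdiv (curl_eq_zero_of_production_eq_zero hrate hcont hmild hdiv hprod)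

/-- **The production-free stratum of the family's profile class is settled**: such a profile is not backward-singular. -/
theorem not_backwardSingular_of_production_eq_zero (hrate : HasTypeITimeDecay C v)
    (hcont : ContinuousOn (uncurry v) (Iio (0 : ℝ) ×ˢ univ))
    (hmild : ∀ s t : ℝ, s < t → t < 0 → ∀ x,
      v t x = UnboundedOperators.heatExtension (v s) (t - s) x - oseenDuhamel 1 s v v t x)
    (hdiv : ∀ t < 0, VectorCalculus.IsDivFree (v t))
    (hprod : ∀ s < 0, ∀ y, ⟪curl (v s) y, fderiv ℝ (v s) y (curl (v s) y)⟫_ℝ = 0) :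
    ¬ IsBackwardSingularPoint v 0 :=
  nonflatLiouville_of_irrotational hrate hcont hmild hdiv (curl_eq_zero_of_production_eq_zero hrate hcont hmild hdiv hprod)

/-! ### window → slab for the production -/

/-- **The enstrophy production `y ↦ ⟪curl v(s)(y), Dv(s)(y)[curl v(s)(y)]⟫` of a slice of a profile of the class is
real-analytic.** -/
theorem analyticOnNhd_production_slice (hrate : HasTypeITimeDecay C v)
    (hcont : ContinuousOn (uncurry v) (Iio (0 : ℝ) ×ˢ univ))
    (hmild : ∀ s t : ℝ, s < t → t < 0 → ∀ x,
      v t x = UnboundedOperators.heatExtension (v s) (t - s) x - oseenDuhamel 1 s v v t x)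
    {s : ℝ} (hs : s < 0) :
    AnalyticOnNhd ℝ (fun y => ⟪curl (v s) y, fderiv ℝ (v s) y (curl (v s) y)⟫_ℝ) univ :=
  analyticOnNhd_inner (analyticOnNhd_curl (analyticOnNhd_slice hcont (bdd_of_hasTypeITimeDecay hrate) hmild hs))
    (analyticOnNhd_stretching_slice hrate hcont hmild hs)

/-- **Window → slab for the production**: vanishing on a nonempty open window of every slice spreads to every slice. -/
theorem productionWindowToSlab (hrate : HasTypeITimeDecay C v)
    (hcont : ContinuousOn (uncurry v) (Iio (0 : ℝ) ×ˢ univ))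
    (hmild : ∀ s t : ℝ, s < t → t < 0 → ∀ x,
      v t x = UnboundedOperators.heatExtension (v s) (t - s) x - oseenDuhamel 1 s v v t x)
    (hwin : ∀ s < 0, ∃ U : Set (EuclideanSpace ℝ (Fin 3)), IsOpen U ∧ U.Nonempty ∧
      ∀ y ∈ U, ⟪curl (v s) y, fderiv ℝ (v s) y (curl (v s) y)⟫_ℝ = 0) :
    ∀ s < 0, ∀ y, ⟪curl (v s) y, fderiv ℝ (v s) y (curl (v s) y)⟫_ℝ = 0 := by
  intro s hs
  obtain ⟨U, hU, hne, hal⟩ := hwin s hs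
  exact real_eq_zero_spread (analyticOnNhd_production_slice hrate hcont hmild hs) hU hne hal

/-- **THE PROFILE WINDOW CRUX OF THE ENSTROPHY-PRODUCTION DOOR, PROVED**: a profile of the family's Type-I class whose
enstrophy production `⟪ω, Dv ω⟫` vanishes on a nonempty open window of every slice `s < 0` is not backward-singular. -/
theorem productionWindowRigidity :
    ∀ (C : ℝ) (v : ℝ → EuclideanSpace ℝ (Fin 3) → EuclideanSpace ℝ (Fin 3)),
      Literature.Analysis.FluidPDE.HasTypeITimeDecay C v →
      ContinuousOn (Function.uncurry v) (Set.Iio (0 : ℝ) ×ˢ Set.univ) →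
      (∀ s t : ℝ, s < t → t < 0 → ∀ x, v t x =
        Literature.Analysis.UnboundedOperators.heatExtension (v s) (t - s) x -
          Literature.Analysis.FluidPDE.oseenDuhamel 1 s v v t x) →
      (∀ t < 0, Literature.Analysis.FluidPDE.VectorCalculus.IsDivFree (v t)) →
      (∀ s < 0, ∃ U : Set (EuclideanSpace ℝ (Fin 3)), IsOpen U ∧ U.Nonempty ∧
        ∀ y ∈ U, ⟪Literature.Analysis.FluidPDE.curl (v s) y,
          fderiv ℝ (v s) y (Literature.Analysis.FluidPDE.curl (v s) y)⟫_ℝ = 0) →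
      ¬ Literature.Analysis.FluidPDE.IsBackwardSingularPoint v 0 :=
  by
  intro C v hrate hcont hmild hdiv hwin
  exact not_backwardSingular_of_production_eq_zero hrate hcont hmild hdiv (productionWindowToSlab hrate hcont hmild hwin)

end Summit.NavierStokesRegularity.NavierStokesRegularity.Theorems.LocalSineTubeDoorEnstrophyProductionProfileRigidity

end
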